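import Mathlib
import Summits.KontsevichZagierPeriods.Zeta5Search.ThirdOrderTypes
import Summits.KontsevichZagierPeriods.Zeta5Search.SecondOrderRaise
import HarnessLib

/-!
# ζ(5) search — the RAISE LEMMA at SECOND order: `σ₂(T + δ_k) = σ₃(T) − kσ₂(T)` (tools for gen-2 g10's THEOREM A⁗, pair identity P1)

Cell `pub-zeta5` (HONEST FRAMING: systematic search; no irrationality claim unless certified), typer seat generation 12.
`SecondOrderRaise.lean` (typer g11) computed the FIRST-order functionals of a raised type: `ŵ(T+δ_k) = ŵ₂(T) − kŵ(T)`,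
`ŵ(T++[1]) = ŵ₂(T) − (L+1)ŵ(T)`, `ŵ(1::T) = ŵ₂(T) + ŵ(T)` (and the `v̂` versions).  Here the SECOND-order functionals
(`typeW2`, `typeV2`) of the raised types are expressed through the third-order functionals `typeW3`, `typeV3` of `ThirdOrderTypes.lean`
(REPORT-gen2-g10 §6.4 (P1): `σ[ηPΦ_T]` for `P = η − k`, `η − (L+1)`, and the shifted `(η+1)²` for `1 :: T`):
* `typeW2_raiseAt`, `typeV2_raiseAt` — `σ₂(T + δ_k) = σ₃(T) − kσ₂(T)` (`k ≤ L`);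
* `typeW2_snocOne`, `typeV2_snocOne` — `σ₂(T ++ [1]) = σ₃(T) − (L+1)σ₂(T)`;
* `typeW2_consOne` — `ŵ₂(1 :: T) = ŵ₃(T) + 2ŵ₂(T) + ŵ(T)` (the `v̂₂` version carries a translation term, treated separately).
Pure algebra of the type products; nothing here bears on irrationality.
-/

noncomputable section

open Finset PowerSeries

namespace Summit.KontsevichZagierPeriods.Zeta5Search.SecondOrder

open Summit.KontsevichZagierPeriods.Zeta5Search.ClusterValuation
open Summit.KontsevichZagierPeriods.Zeta5Search.LevelClass (typeRho typeW typeV typeExp)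
open Summit.KontsevichZagierPeriods.Zeta5Search.CellA (harm_succ)
open Literature.NumberTheory.Transcendental.BallRivoal (harm)

/-! ## §1 Raise at an existing level -/

/-- **`ŵ₂(T+δ_k) = ŵ₃(T) − k ŵ₂(T)`** for `k ≤ L`. -/
theorem typeW2_raiseAt {L : ℕ} (e : ℕ → ℤ) {k : ℕ} (hk : k ≤ L) :
    typeW2 L (raiseAt e k) = typeW3 L e - (k : ℚ) * typeW2 L e := by
  unfold typeW2 typeW3
  rw [sum_filter, sum_filter, sum_filter, mul_sum, ← sum_sub_distrib]
  refine sum_congr rfl fun i hi => ?_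
  have hiL : i ≤ L := by have := mem_range.1 hi; omega
  by_cases hik : i = k
  · subst hik
    have hr : raiseAt e i i = e i + 1 := by rw [raiseAt, if_pos rfl]
    simp only [hr, typeRho_raiseAt_self]
    split_ifs <;> first | omega | ring
  · have hr : raiseAt e k i = e i := by rw [raiseAt, if_neg hik]
    have hρ3 : e i ≤ -3 → typeRho L (raiseAt e k) i 3 =
        ((i : ℚ) - k) * typeRho L e i 3 + (if e i ≤ -4 then typeRho L e i 4 else 0) := fun h => by
      rw [typeRho_raiseAt e hk hik (by push_cast; omega)]
      congr 1
      split_ifs <;> first | rfl | omega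
    have hρ4 : e i ≤ -4 → typeRho L (raiseAt e k) i 4 =
        ((i : ℚ) - k) * typeRho L e i 4 + (if e i ≤ -5 then typeRho L e i 5 else 0) := fun h => by
      rw [typeRho_raiseAt e hk hik (by push_cast; omega)]
      congr 1
      split_ifs <;> first | rfl | omega
    simp only [hr]
    by_cases h3 : e i ≤ -3
    · rw [hρ3 h3]
      by_cases h4 : e i ≤ -4
      · rw [hρ4 h4]
        split_ifs <;> first | omega | ring
      · split_ifs <;> first | omega | ring
    · split_ifs <;> first | omega | ring

/-- **`v̂₂(T+δ_k) = v̂₃(T) − k v̂₂(T)`** for `k ≤ L`. -/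
theorem typeV2_raiseAt {L : ℕ} (e : ℕ → ℤ) {k : ℕ} (hk : k ≤ L) :
    typeV2 L (raiseAt e k) = typeV3 L e - (k : ℚ) * typeV2 L e := by
  unfold typeV2 typeV3
  rw [sum_filter, sum_filter, sum_filter, mul_sum, ← sum_sub_distrib]
  refine sum_congr rfl fun i hi => ?_
  have hiL : i ≤ L := by have := mem_range.1 hi; omega
  by_cases hik : i = k
  · subst hik
    have hr : raiseAt e i i = e i + 1 := by rw [raiseAt, if_pos rfl]
    rw [hr]
    by_cases h2 : e i ≤ -2
    · -- the pole survives with order `n − 1`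
      rw [if_pos (show e i + 1 < 0 by omega), if_pos (show e i < 0 by omega), if_pos (show e i < 0 by omega), mul_sum,
        ← sum_sub_distrib]
      obtain ⟨n, hn⟩ : ∃ n : ℕ, (-e i).toNat = n + 1 := ⟨(-e i).toNat - 1, by omega⟩
      rw [show (-(e i + 1)).toNat = n by omega, hn, Finset.sum_Icc_succ_top (show 1 ≤ n + 1 by omega)]
      refine Eq.trans (sum_congr rfl fun σ hσ => ?_) (left_eq_add.2 ?_)
      · have hσ' := mem_Icc.1 hσ
        simp only [typeRho_raiseAt_self]
        split_ifs <;> first | omega | ring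
      · split_ifs <;> first | omega | ring
    · rw [if_neg (show ¬ e i + 1 < 0 by omega)]
      by_cases h0 : e i < 0
      · have h1 : (-e i).toNat = 0 + 1 := by omega
        rw [if_pos h0, if_pos h0, h1, Finset.sum_Icc_succ_top (by omega), Finset.sum_Icc_succ_top (by omega)]
        simp only [show Icc 1 0 = ∅ by rfl, sum_empty, zero_add]
        split_ifs <;> first | omega | ring
      · rw [if_neg h0, if_neg h0]; ring
  · have hr : raiseAt e k i = e i := by rw [raiseAt, if_neg hik]
    rw [hr]
    by_cases h0 : e i < 0
    · rw [if_pos h0, if_pos h0, if_pos h0, mul_sum, ← sum_sub_distrib]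
      refine sum_congr rfl fun σ hσ => ?_
      have hσ' := (mem_Icc.1 hσ)
      have hρ1 : (σ : ℤ) + 1 ≤ -e i → typeRho L (raiseAt e k) i (σ + 1) =
          ((i : ℚ) - k) * typeRho L e i (σ + 1) + (if (σ : ℤ) + 2 ≤ -e i then typeRho L e i (σ + 2) else 0) := fun h => by
        rw [typeRho_raiseAt e hk hik h]
        congr 1
      rw [typeRho_raiseAt e hk hik (show (σ : ℤ) ≤ -e i by omega)]
      by_cases hs1 : (σ : ℤ) + 1 ≤ -e i
      · rw [hρ1 hs1]
        split_ifs <;> first | omega | ring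
      · split_ifs <;> first | omega | ring
    · rw [if_neg h0, if_neg h0, if_neg h0]; ring

/-! ## §2 A new end point -/

/-- **`ŵ₂(T ++ [1]) = ŵ₃(T) − (L+1) ŵ₂(T)`.** -/
theorem typeW2_snocOne (L : ℕ) (e : ℕ → ℤ) :
    typeW2 (L + 1) (snocOne e L) = typeW3 L e - ((L + 1 : ℕ) : ℚ) * typeW2 L e := by
  unfold typeW2 typeW3
  rw [sum_filter, sum_filter, sum_filter, mul_sum, ← sum_sub_distrib, sum_range_succ,
    show snocOne e L (L + 1) = 1 by rw [snocOne, if_pos rfl], if_neg (by norm_num), add_zero]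
  refine sum_congr rfl fun i hi => ?_
  have hiL : i ≤ L := by have := mem_range.1 hi; omega
  have hr : snocOne e L i = e i := by rw [snocOne, if_neg (by omega)]
  have hρ3 : e i ≤ -3 → typeRho (L + 1) (snocOne e L) i 3 =
      ((i : ℚ) - ((L + 1 : ℕ) : ℚ)) * typeRho L e i 3 + (if e i ≤ -4 then typeRho L e i 4 else 0) := fun h => by
    rw [typeRho_snocOne e hiL (by push_cast; omega)]
    congr 1
    split_ifs <;> first | rfl | omega
  have hρ4 : e i ≤ -4 → typeRho (L + 1) (snocOne e L) i 4 =
      ((i : ℚ) - ((L + 1 : ℕ) : ℚ)) * typeRho L e i 4 + (if e i ≤ -5 then typeRho L e i 5 else 0) := fun h => by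
    rw [typeRho_snocOne e hiL (by push_cast; omega)]
    congr 1
    split_ifs <;> first | rfl | omega
  simp only [hr]
  by_cases h3 : e i ≤ -3
  · rw [hρ3 h3]
    by_cases h4 : e i ≤ -4
    · rw [hρ4 h4]
      push_cast
      split_ifs <;> first | omega | ring
    · push_cast
      split_ifs <;> first | omega | ring
  · push_cast
    split_ifs <;> first | omega | ring

/-- **`v̂₂(T ++ [1]) = v̂₃(T) − (L+1) v̂₂(T)`.** -/
theorem typeV2_snocOne (L : ℕ) (e : ℕ → ℤ) :
    typeV2 (L + 1) (snocOne e L) = typeV3 L e - ((L + 1 : ℕ) : ℚ) * typeV2 L e := by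
  unfold typeV2 typeV3
  rw [sum_filter, sum_filter, sum_filter, mul_sum, ← sum_sub_distrib, sum_range_succ,
    show snocOne e L (L + 1) = 1 by rw [snocOne, if_pos rfl], if_neg (by norm_num), add_zero]
  refine sum_congr rfl fun i hi => ?_
  have hiL : i ≤ L := by have := mem_range.1 hi; omega
  have hr : snocOne e L i = e i := by rw [snocOne, if_neg (by omega)]
  rw [hr]
  by_cases h0 : e i < 0
  · rw [if_pos h0, if_pos h0, if_pos h0, mul_sum, ← sum_sub_distrib]
    refine sum_congr rfl fun σ hσ => ?_
    have hσ' := (mem_Icc.1 hσ)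
    have hρ1 : (σ : ℤ) + 1 ≤ -e i → typeRho (L + 1) (snocOne e L) i (σ + 1) =
        ((i : ℚ) - ((L + 1 : ℕ) : ℚ)) * typeRho L e i (σ + 1) + (if (σ : ℤ) + 2 ≤ -e i then typeRho L e i (σ + 2) else 0) :=
      fun h => by
      rw [typeRho_snocOne e hiL h]
      congr 1
    rw [typeRho_snocOne e hiL (show (σ : ℤ) ≤ -e i by omega)]
    by_cases hs1 : (σ : ℤ) + 1 ≤ -e i
    · rw [hρ1 hs1]
      push_cast
      split_ifs <;> first | omega | ring
    · push_cast
      split_ifs <;> first | omega | ring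
  · rw [if_neg h0, if_neg h0, if_neg h0]; ring

/-! ## §3 A new first point (`W`-row) -/

/-- **`ŵ₂(1 :: T) = ŵ₃(T) + 2ŵ₂(T) + ŵ(T)`.** -/
theorem typeW2_consOne (L : ℕ) (e : ℕ → ℤ) :
    typeW2 (L + 1) (consOne e) = typeW3 L e + 2 * typeW2 L e + typeW L e := by
  unfold typeW typeW2 typeW3
  rw [sum_filter, sum_filter, sum_filter, sum_filter, mul_sum, ← sum_add_distrib, ← sum_add_distrib, sum_range_succ',
    show consOne e 0 = 1 by rw [consOne, if_pos rfl], if_neg (by norm_num), add_zero]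
  refine sum_congr rfl fun i hi => ?_
  have hiL : i ≤ L := by have := mem_range.1 hi; omega
  have hr : consOne e (i + 1) = e i := by rw [consOne, if_neg (by omega), Nat.add_sub_cancel]
  have hρ3 : e i ≤ -3 → typeRho (L + 1) (consOne e) (i + 1) 3 =
      (((i : ℕ) : ℚ) + 1) * typeRho L e i 3 + (if e i ≤ -4 then typeRho L e i 4 else 0) := fun h => by
    rw [typeRho_consOne e i (by push_cast; omega)]
    congr 1
    split_ifs <;> first | rfl | omega
  have hρ4 : e i ≤ -4 → typeRho (L + 1) (consOne e) (i + 1) 4 =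
      (((i : ℕ) : ℚ) + 1) * typeRho L e i 4 + (if e i ≤ -5 then typeRho L e i 5 else 0) := fun h => by
    rw [typeRho_consOne e i (by push_cast; omega)]
    congr 1
    split_ifs <;> first | rfl | omega
  simp only [hr]
  by_cases h3 : e i ≤ -3
  · rw [hρ3 h3]
    by_cases h4 : e i ≤ -4
    · rw [hρ4 h4]
      push_cast
      split_ifs <;> first | omega | ring
    · push_cast
      split_ifs <;> first | omega | ring
  · push_cast
    split_ifs <;> first | omega | ring

end Summit.KontsevichZagierPeriods.Zeta5Search.SecondOrder

end
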